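import Summits.Ventures.WeilGRH.GL2BaseRungTransfer
import Summits.Ventures.WeilGRH.OnePrimeTransfer
import HarnessLib

/-!
# GL₂ windows with ONE prime inside (`2a ≤ log 3`) by transfer from a `ζ` rung:
# `WeilPositivityOnGL2 k N Λf ((log 3)/2)` for even `k ≥ 2`, `‖Λf 2‖ ≤ 2 log 2`, `N ≥ 5000`

Cell `rh-explicit`, P-1 «A2-ext» (producer seat rh-explicit-moll-step0-2), sequel of
`GL2BaseRungTransfer.lean`. On a window `[-a, a]` with `2a ≤ log 3` the only prime power entering the
explicit formula of `h = g ⋆ g̃` is `n = 2`; for the typed GL₂ functional (`weilQuadraticGL2`, weil-grh-1)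
`Re Q_f(g) = ‖g‖₂²(log N − 2 log 2π) + (1/π)∫|ĝ(½+it)|² Re ψ(k/2+it) dt − Re[(Λf(2) h(log 2) + conj Λf(2) h(−log 2))/√2]`,
while for `ζ`: `Re Q(g) = 2 Re(ĝ(0) conj ĝ(1)) − Re[(log 2/√2)(h(log 2) + h(−log 2))] + (1/2π) A₀ − (log π)‖g‖₂²`.
With the density comparison `∫|ĝ|² Re ψ(m+it) ≥ A₀ + 2π (log 2) ‖g‖₂²` (`arch_integral_quarter_add_le`),
the polar bound `weilPolar_re_le` and `|h(± log 2)| ≤ ‖g‖₂²` (`norm_weilConv_weilReflect_le`):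
`Re Q_f(g) ≥ ‖g‖₂² (log N − 4(sinh a + a) − √2‖2 log 2 − Λf 2‖)` whenever `WeilPositivityOn a` (`ζ`).
RESULTS: `weilPositivityOnGL2_of_one_prime` (generic: `2a ≤ log 3`, `hζ : WeilPositivityOn a`,
`4(sinh a + a) + √2‖2 log 2 − Λf 2‖ ≤ log N`); at Yoshida's kernel-checked rung `(log 3)/2`
(`weilPositivityOn_log_three_half`) and under the Ramanujan-type bound `‖Λf 2‖ ≤ 2 log 2`
(`|b(2)| ≤ 2`): **`weilPositivityOnGL2_log_three_half_of_ge_5000`** — `WeilPositivityOnGL2 k N Λf ((log 3)/2)`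
for every even `k ≥ 2` and `N ≥ 5000` (`4/√3 + 2 log 3 + 4√2 log 2 = 8.4277 < 2 log 3 + 25/4 < log 5000`).
(The producer's certificate EXTREMALS/GL2-ext/log3half-a2scan-CERT gives `N ≥ 31` for `k = 2`; the transfer
is what the Lean kernel alone certifies.) Honest framing: window positivity of the typed functional with a
coefficient PARAMETER `Λf`; no statement about modular-form `L`-functions (none in the tree).
-/

noncomputable section

open Complex Filter Set MeasureTheory
open scoped Real Topology ComplexConjugate ArithmeticFunction.vonMangoldt

namespace Summit.Ventures.WeilGRH

open Literature.NumberTheory.LFunctions Literature.Analysis.SpecialFunctions.Complex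

variable {g : ℝ → ℂ}

/-- On `[-log 3, log 3]` the prime term of the holomorphic datum collects only `n = 2`:
`Σ_n n^{-1/2}(Λf(n) h(log n) + conj Λf(n) h(−log n)) = (Λf(2) h(log 2) + conj Λf(2) h(−log 2))/√2`
(`Λf 0 = Λf 1 = 0`; `h(± log n) = 0` for `n ≥ 3`). [folklore] -/
theorem primeTerm_holomorphic_eq_single_two {k : ℕ} {Λf : ℕ → ℂ} (h0 : Λf 0 = 0) (h1 : Λf 1 = 0)
    {h : ℝ → ℂ} (hh : Continuous h) (hs : tsupport h ⊆ Icc (-Real.log 3) (Real.log 3)) :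
    (weilLDatumHolomorphic k 1 Λf).primeTerm h =
      (Λf 2 * h (Real.log (2 : ℕ)) + conj (Λf 2) * h (-Real.log (2 : ℕ))) / (Real.sqrt (2 : ℕ) : ℂ) := by
  unfold WeilLDatum.primeTerm
  have hv : (weilLDatumHolomorphic k 1 Λf).vonMangoldt = Λf := rfl
  rw [hv]
  refine tsum_eq_single 2 fun n hn ↦ ?_
  have hsupp := support_subset_Ioo_of_tsupport_subset_Icc hh hs
  rcases Nat.lt_or_ge n 3 with h3 | h3
  · interval_cases n
    · simp [h0]
    · simp [h1]
    · exact absurd rfl hn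
  · have hlog : Real.log 3 ≤ Real.log n := Real.log_le_log (by norm_num) (by exact_mod_cast h3)
    have e1 : h (Real.log n) = 0 := by
      by_contra hne; have := (hsupp hne).2; linarith
    have e2 : h (-Real.log n) = 0 := by
      by_contra hne; have := (hsupp hne).1; linarith
    simp [e1, e2]

/-- **One prime inside, closed form**: for `Λf 0 = Λf 1 = 0`, `supp g ⊆ [-a, a]`, `2a ≤ log 3`:
`Re Q_f(g) = ‖g‖₂²(log N − 2 log 2π) + (1/π)∫|ĝ(½+it)|² Re ψ(k/2+it) dt − Re[(Λf(2) h(log 2) + conj Λf(2) h(−log 2))/√2]`,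
`h = g ⋆ g̃`. [cite: IwaniecKowalski2004, §5.5 Thm 5.12 (5.45) (one prime power below 3)] -/
theorem re_weilQuadraticGL2_of_tsupport_subset_log_three {k N : ℕ} {Λf : ℕ → ℂ} (h0 : Λf 0 = 0)
    (h1 : Λf 1 = 0) (hg : IsWeilTest g) {a : ℝ} (hsupp : tsupport g ⊆ Icc (-a) a)
    (ha : 2 * a ≤ Real.log 3) :
    (weilQuadraticGL2 k N Λf g).re =
      (∫ t : ℝ, ‖g t‖ ^ 2) * (Real.log N - 2 * Real.log (2 * π)) +
        1 / π * (∫ t : ℝ, ‖weilMellin g (1 / 2 + t * I)‖ ^ 2 * (digamma ((k : ℂ) / 2 + t * I)).re) -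
        ((Λf 2 * weilConv g (weilReflect g) (Real.log (2 : ℕ)) +
          conj (Λf 2) * weilConv g (weilReflect g) (-Real.log (2 : ℕ))) / (Real.sqrt (2 : ℕ) : ℂ)).re := by
  have hk : IsWeilTest (weilConv g (weilReflect g)) := hg.weilConv hg.weilReflect
  have hsub : tsupport (weilConv g (weilReflect g)) ⊆ Icc (-Real.log 3) (Real.log 3) :=
    (tsupport_weilConv_weilReflect_subset hg.2 hsupp).trans (Icc_subset_Icc (by linarith) ha)
  rw [weilQuadraticGL2, primeTerm_holomorphic_eq_single_two h0 h1 hk.1.continuous hsub,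
    weilConv_weilReflect_apply_zero, sub_re]
  congr 1
  have hA : (∫ t : ℝ, weilMellin (weilConv g (weilReflect g)) (1 / 2 + t * I) *
      ((digamma ((k : ℂ) / 2 + t * I)).re : ℂ)) =
      ((∫ t : ℝ, ‖weilMellin g (1 / 2 + t * I)‖ ^ 2 * (digamma ((k : ℂ) / 2 + t * I)).re : ℝ) : ℂ) := by
    rw [← integral_complex_ofReal]
    congr 1 with t
    rw [weilMellin_weilConv_weilReflect_half hg]
    push_cast; ring
  rw [hA, show ((1 / π : ℂ)) = ((1 / π : ℝ) : ℂ) by push_cast; ring]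
  simp only [← Complex.ofReal_mul, ← Complex.ofReal_add, Complex.ofReal_re]
  ring

/-- The `ζ` prime term on `[-log 3, log 3]`: `Σ_n Λ(n) n^{-1/2}(h(log n) + h(−log n)) =
(log 2/√2)(h(log 2) + h(−log 2))`. [folklore] -/
theorem weilPrimeTerm_eq_single_two {h : ℝ → ℂ} (hh : Continuous h)
    (hs : tsupport h ⊆ Icc (-Real.log 3) (Real.log 3)) :
    weilPrimeTerm h =
      ((Real.log 2 / Real.sqrt 2 : ℝ) : ℂ) * (h (Real.log (2 : ℕ)) + h (-Real.log (2 : ℕ))) := by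
  unfold weilPrimeTerm
  rw [tsum_eq_single 2 fun n hn ↦ ?_]
  · rw [ArithmeticFunction.vonMangoldt_apply_prime Nat.prime_two]
    push_cast; ring
  · rcases vonMangoldt_eq_zero_or_apply_log_eq_zero hh hs hn with hz | ⟨hz1, hz2⟩
    · simp [hz]
    · simp [hz1, hz2]

/-- **GL₂ one-prime transfer.** For even `k ≥ 2`, `Λf 0 = Λf 1 = 0`, a window `2a ≤ log 3` on which
Weil positivity for `ζ` holds, and `4(sinh a + a) + √2·‖2 log 2 − Λf 2‖ ≤ log N`:
`WeilPositivityOnGL2 k N Λf a` (`Re Q_f(g) ≥ ‖g‖₂²(log N − 4(sinh a + a) − √2‖2 log 2 − Λf 2‖)`).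
[cite: IwaniecKowalski2004, §5.5 Thm 5.12 (5.45); Yoshida1992, Thm 1] -/
theorem weilPositivityOnGL2_of_one_prime {k N : ℕ} {Λf : ℕ → ℂ} (hk : Even k) (hk2 : 2 ≤ k)
    (h0 : Λf 0 = 0) (h1 : Λf 1 = 0) {a : ℝ} (ha : 2 * a ≤ Real.log 3) (hζ : WeilPositivityOn a)
    (hN : 4 * (Real.sinh a + a) + Real.sqrt 2 * ‖2 * (Real.log 2 : ℂ) - Λf 2‖ ≤ Real.log N) :
    WeilPositivityOnGL2 k N Λf a := by
  intro g hg hsupp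
  obtain ⟨m, hkm⟩ := hk
  have hm : 1 ≤ m := by omega
  -- the GL₂ side (before the abbreviations, so that they apply to it)
  have hQ := re_weilQuadraticGL2_of_tsupport_subset_log_three (k := k) (N := N) h0 h1 hg hsupp ha
  have hk2c : ∀ t : ℝ, ((k : ℂ) / 2 + t * I) = ((m : ℂ) + t * I) := by
    intro t; rw [hkm]; push_cast; ring
  simp_rw [hk2c] at hQ
  set h := weilConv g (weilReflect g) with hh
  have hht : IsWeilTest h := hg.weilConv hg.weilReflect
  have hhs : tsupport h ⊆ Icc (-Real.log 3) (Real.log 3) :=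
    (tsupport_weilConv_weilReflect_subset hg.2 hsupp).trans (Icc_subset_Icc (by linarith) ha)
  set Ng : ℝ := ∫ t : ℝ, ‖g t‖ ^ 2 with hNg
  set A0 : ℝ := ∫ t : ℝ, ‖weilMellin g (1 / 2 + t * I)‖ ^ 2 *
      (digamma (1 / 4 + t / 2 * I)).re with hA0
  set Am : ℝ := ∫ t : ℝ, ‖weilMellin g (1 / 2 + t * I)‖ ^ 2 *
      (digamma ((m : ℂ) + t * I)).re with hAm
  set P : ℝ := 2 * (weilMellin g 0 * conj (weilMellin g 1)).re with hP
  set c : ℂ := Λf 2 with hc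
  set u : ℂ := h (Real.log (2 : ℕ)) with hu
  set v : ℂ := h (-Real.log (2 : ℕ)) with hv
  -- the `ζ` side: `0 ≤ P − Re D_ζ + (1/2π) A0 − Ng log π`
  have hζg : 0 ≤ (weilQuadratic g).re := hζ g hg hsupp
  have hZ : weilQuadratic g = weilPolarTerm h - weilPrimeTerm h + weilArchTerm h := rfl
  have hζre : (weilQuadratic g).re =
      P - (((Real.log 2 / Real.sqrt 2 : ℝ) : ℂ) * (u + v)).re +
        (1 / (2 * π) * A0 - Ng * Real.log π) := by
    rw [hZ, weilArchTerm, hh, weilPolarTerm_weilConv_weilReflect hg,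
      weilPrimeTerm_eq_single_two hht.1.continuous hhs, weilArchIntegral_weilConv_weilReflect hg,
      weilConv_weilReflect_apply_zero,
      show ((1 / (2 * π) : ℂ)) = ((1 / (2 * π) : ℝ) : ℂ) by push_cast; ring]
    simp only [sub_re, add_re, Complex.ofReal_re, Complex.re_ofReal_mul, Complex.re_mul_ofReal, hP,
      hu, hv, hNg, hA0]
  -- the correction `E = 2 D_ζ − D_f` and its bound
  set E : ℂ := ((2 * (Real.log 2 : ℂ) - c) * u + (2 * (Real.log 2 : ℂ) - conj c) * v) /
    (Real.sqrt (2 : ℕ) : ℂ) with hE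
  have hs0 : (0 : ℝ) < Real.sqrt 2 := by positivity
  have hsq : Real.sqrt 2 * Real.sqrt 2 = 2 := Real.mul_self_sqrt (by norm_num)
  have hErel : 2 * (((Real.log 2 / Real.sqrt 2 : ℝ) : ℂ) * (u + v)).re -
      ((c * u + conj c * v) / (Real.sqrt (2 : ℕ) : ℂ)).re = E.re := by
    have hcx : (2 : ℂ) * (((Real.log 2 / Real.sqrt 2 : ℝ) : ℂ) * (u + v)) -
        (c * u + conj c * v) / (Real.sqrt (2 : ℕ) : ℂ) = E := by
      have hs0' : (Real.sqrt 2 : ℂ) ≠ 0 := Complex.ofReal_ne_zero.2 hs0.ne'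
      simp only [hE, Nat.cast_ofNat]
      push_cast
      field_simp
      ring
    have := congrArg Complex.re hcx
    simpa only [Complex.sub_re, Complex.mul_re, Complex.re_ofNat, Complex.im_ofNat, zero_mul,
      sub_zero] using this
  have hNg0 : 0 ≤ Ng := integral_nonneg fun t ↦ by positivity
  have hun : ‖u‖ ≤ Ng := norm_weilConv_weilReflect_le hg _
  have hvn : ‖v‖ ≤ Ng := norm_weilConv_weilReflect_le hg _
  have hconj : ‖2 * (Real.log 2 : ℂ) - conj c‖ = ‖2 * (Real.log 2 : ℂ) - c‖ := by
    rw [show (2 : ℂ) * (Real.log 2 : ℂ) - conj c = conj (2 * (Real.log 2 : ℂ) - c) by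
      simp only [map_sub, map_mul, map_ofNat, Complex.conj_ofReal], Complex.norm_conj]
  have hEn : ‖E‖ ≤ Real.sqrt 2 * ‖2 * (Real.log 2 : ℂ) - c‖ * Ng := by
    have hden : ‖(Real.sqrt (2 : ℕ) : ℂ)‖ = Real.sqrt 2 := by
      rw [Nat.cast_ofNat, Complex.norm_real, Real.norm_eq_abs, abs_of_pos hs0]
    rw [hE, norm_div, hden, div_le_iff₀ hs0]
    calc ‖(2 * (Real.log 2 : ℂ) - c) * u + (2 * (Real.log 2 : ℂ) - conj c) * v‖
        ≤ ‖2 * (Real.log 2 : ℂ) - c‖ * Ng + ‖2 * (Real.log 2 : ℂ) - c‖ * Ng := by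
          refine (norm_add_le _ _).trans (add_le_add ?_ ?_)
          · rw [norm_mul]; exact mul_le_mul_of_nonneg_left hun (norm_nonneg _)
          · rw [norm_mul, hconj]; exact mul_le_mul_of_nonneg_left hvn (norm_nonneg _)
      _ = Real.sqrt 2 * ‖2 * (Real.log 2 : ℂ) - c‖ * Ng * Real.sqrt 2 := by
          rw [show Real.sqrt 2 * ‖2 * (Real.log 2 : ℂ) - c‖ * Ng * Real.sqrt 2 =
            (Real.sqrt 2 * Real.sqrt 2) * ‖2 * (Real.log 2 : ℂ) - c‖ * Ng by ring, hsq]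
          ring
  have hEre : -(Real.sqrt 2 * ‖2 * (Real.log 2 : ℂ) - c‖ * Ng) ≤ E.re := by
    have := (abs_le.1 (Complex.abs_re_le_norm E)).1
    linarith
  -- the density comparison and the polar bound
  have hA : A0 + 2 * π * Real.log 2 * Ng ≤ Am := arch_integral_quarter_add_le hg hm
  have hPle : P ≤ 2 * (Real.sinh a + a) * Ng := weilPolar_re_le hg hsupp
  have hπ : 0 < π := Real.pi_pos
  have hlog2π : Real.log (2 * π) = Real.log 2 + Real.log π := Real.log_mul (by norm_num) hπ.ne'
  rw [hQ, hlog2π]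
  have hq1 : 1 / π * Am ≥ 1 / π * (A0 + 2 * π * Real.log 2 * Ng) :=
    mul_le_mul_of_nonneg_left hA (by positivity)
  have hq2 : 1 / π * (A0 + 2 * π * Real.log 2 * Ng) = 2 * (1 / (2 * π) * A0) + 2 * Real.log 2 * Ng := by
    field_simp
  rw [hζre] at hζg
  nlinarith [mul_le_mul_of_nonneg_right hN hNg0, hErel, hEre]

/-- Numerics at `(log 3)/2`: `4(1/√3 + (log 3)/2) + √2·(4 log 2) ≤ log 5000`
(`= 4/√3 + log 9 + 4√2 log 2`; `4/√3 < 2.3096`, `4√2 log 2 < 3.9211`, `6.2307 < 25/4 < log(5000/9)` since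
`e^{25} < 2.7182818286^{25} < (5000/9)^4`). [folklore] -/
theorem one_prime_gl2_numerics_log_three_half :
    4 * (1 / Real.sqrt 3 + Real.log 3 / 2) + Real.sqrt 2 * (4 * Real.log 2) ≤ Real.log 5000 := by
  have hs3 : (1.73205 : ℝ) < Real.sqrt 3 := by
    rw [show (1.73205 : ℝ) = Real.sqrt (1.73205 ^ 2) by rw [Real.sqrt_sq (by norm_num)]]
    exact Real.sqrt_lt_sqrt (by norm_num) (by norm_num)
  have h1 : 1 / Real.sqrt 3 < 0.5774 := by
    rw [div_lt_iff₀ (by positivity)]; nlinarith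
  have hs2 : Real.sqrt 2 < 1.41422 := by
    rw [show (1.41422 : ℝ) = Real.sqrt (1.41422 ^ 2) by rw [Real.sqrt_sq (by norm_num)]]
    exact Real.sqrt_lt_sqrt (by norm_num) (by norm_num)
  have hl2 : Real.log 2 < 0.6931471808 := Real.log_two_lt_d9
  have hl20 : 0 ≤ Real.log 2 := Real.log_nonneg (by norm_num)
  have hprod : Real.sqrt 2 * Real.log 2 ≤ 1.41422 * 0.6931471808 :=
    mul_le_mul hs2.le hl2.le hl20 (by norm_num)
  have h9 : Real.log 5000 = 2 * Real.log 3 + Real.log (5000 / 9) := by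
    rw [show (5000 : ℝ) = 3 ^ 2 * (5000 / 9) by norm_num, Real.log_mul (by norm_num) (by norm_num),
      Real.log_pow]
    norm_num
  have he : Real.exp 1 < 2.7182818286 := Real.exp_one_lt_d9
  have h25 : Real.exp 25 < (5000 / 9 : ℝ) ^ 4 := by
    have h' : Real.exp 25 = Real.exp 1 ^ 25 := by rw [← Real.exp_nat_mul]; norm_num
    rw [h']
    have hp : Real.exp 1 ^ 25 < (2.7182818286 : ℝ) ^ 25 :=
      pow_lt_pow_left₀ he (Real.exp_pos 1).le (by norm_num)
    have hn : (2.7182818286 : ℝ) ^ 25 < (5000 / 9 : ℝ) ^ 4 := by norm_num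
    linarith
  have h3 : (25 / 4 : ℝ) < Real.log (5000 / 9) := by
    rw [Real.lt_log_iff_exp_lt (by norm_num)]
    have hpow : Real.exp (25 / 4) ^ 4 = Real.exp 25 := by rw [← Real.exp_nat_mul]; norm_num
    have hlt : Real.exp (25 / 4) ^ 4 < (5000 / 9 : ℝ) ^ 4 := by rw [hpow]; exact h25
    exact lt_of_pow_lt_pow_left₀ 4 (by norm_num) hlt
  rw [h9]
  nlinarith [hprod]

/-- **The rung `(log 3)/2` for GL₂ by transfer**: for every even weight `k ≥ 2`, every level `N ≥ 5000`
and every coefficient function with `Λf 0 = Λf 1 = 0`, `‖Λf 2‖ ≤ 2 log 2` (the Ramanujan bound `|b(2)| ≤ 2`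
for `Λf(2) = b(2) log 2`): `WeilPositivityOnGL2 k N Λf ((log 3)/2)` — from Yoshida's kernel-checked `ζ`
rung `weilPositivityOn_log_three_half` by the one-prime transfer. [cite: IwaniecKowalski2004, §5.5 Thm 5.12 (5.45); Yoshida1992, Thm 1 (p. 310)] -/
theorem weilPositivityOnGL2_log_three_half_of_ge_5000 {k N : ℕ} {Λf : ℕ → ℂ} (hk : Even k)
    (hk2 : 2 ≤ k) (h0 : Λf 0 = 0) (h1 : Λf 1 = 0) (hΛ : ‖Λf 2‖ ≤ 2 * Real.log 2) (hN : 5000 ≤ N) :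
    WeilPositivityOnGL2 k N Λf (Real.log 3 / 2) := by
  refine weilPositivityOnGL2_of_one_prime hk hk2 h0 h1 (by linarith) weilPositivityOn_log_three_half ?_
  have hlogN : Real.log 5000 ≤ Real.log N := Real.log_le_log (by norm_num) (by exact_mod_cast hN)
  have hnorm : ‖2 * (Real.log 2 : ℂ) - Λf 2‖ ≤ 4 * Real.log 2 := by
    have h2 : ‖(2 : ℂ) * (Real.log 2 : ℂ)‖ = 2 * Real.log 2 := by
      rw [show (2 : ℂ) * (Real.log 2 : ℂ) = ((2 * Real.log 2 : ℝ) : ℂ) by push_cast; ring,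
        Complex.norm_real, Real.norm_eq_abs, abs_of_nonneg (by positivity)]
    calc ‖2 * (Real.log 2 : ℂ) - Λf 2‖ ≤ ‖(2 : ℂ) * (Real.log 2 : ℂ)‖ + ‖Λf 2‖ := norm_sub_le _ _
      _ ≤ 4 * Real.log 2 := by rw [h2]; linarith
  have hs20 : 0 ≤ Real.sqrt 2 := Real.sqrt_nonneg _
  rw [sinh_log_three_half]
  nlinarith [one_prime_gl2_numerics_log_three_half, mul_le_mul_of_nonneg_left hnorm hs20]

/-! ## In the IK-datum vocabulary (weil-grh-1's dictionary `weilPositivityOnGL2_iff`) -/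

/-- The base rung for the IK datum of a weight-`k`, level-`N` holomorphic form: `(weilLDatumHolomorphic k N Λf).PositivityOn ((log 2)/2)`
for even `k ≥ 2`, `N ≥ 17`, `Λf 0 = Λf 1 = 0`. [cite: IwaniecKowalski2004, §5.5 Thm 5.12 (5.45); Yoshida1992, Thm 1] -/
theorem positivityOn_holomorphic_log_two_half_of_ge_17 {k N : ℕ} [NeZero N] {Λf : ℕ → ℂ}
    (hk : Even k) (hk2 : 2 ≤ k) (hN : 17 ≤ N) (h0 : Λf 0 = 0) (h1 : Λf 1 = 0) :
    (weilLDatumHolomorphic k N Λf).PositivityOn (Real.log 2 / 2) :=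
  (weilPositivityOnGL2_iff (by omega) _).1 (weilPositivityOnGL2_log_two_half_of_ge_17 hk hk2 hN h0 h1)

/-- The rung `(log 3)/2` for the IK datum: `(weilLDatumHolomorphic k N Λf).PositivityOn ((log 3)/2)` for even
`k ≥ 2`, `N ≥ 5000`, `Λf 0 = Λf 1 = 0`, `‖Λf 2‖ ≤ 2 log 2`. [cite: IwaniecKowalski2004, §5.5 Thm 5.12 (5.45); Yoshida1992, Thm 1] -/
theorem positivityOn_holomorphic_log_three_half_of_ge_5000 {k N : ℕ} [NeZero N] {Λf : ℕ → ℂ}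
    (hk : Even k) (hk2 : 2 ≤ k) (h0 : Λf 0 = 0) (h1 : Λf 1 = 0) (hΛ : ‖Λf 2‖ ≤ 2 * Real.log 2)
    (hN : 5000 ≤ N) : (weilLDatumHolomorphic k N Λf).PositivityOn (Real.log 3 / 2) :=
  (weilPositivityOnGL2_iff (by omega) _).1
    (weilPositivityOnGL2_log_three_half_of_ge_5000 hk hk2 h0 h1 hΛ hN)

end Summit.Ventures.WeilGRH

end
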